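import Summits.AtomisticToContinuum.Crystallization.Theorems.PerronTransitivityUniformBindingRigidityCohesionB

/-!
# Negative knowledge for crux `PerronTransitivity.TransitiveLocalLimit` (stmt-AtomisticToContinuum-15100), III:
# `2E*` is the UNIFORM BINDING FLOOR of every uniformly discrete configuration — the level of the crux is sharp

Refuter vetting (cdisprove, `--supports stmt-AtomisticToContinuum-15100`). The crux asks for a local limit `X`
of Lennard-Jones ground states with `U_X(p) = 2E*` at EVERY site (`U_X(p) = ∑'_{q ∈ X, q ≠ p} V_LJ(dist p q)`,
`E* = ⨅_Q e_LJ(Q)`).  This file certifies that the level cannot be lowered uniformly, for ANY configuration: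

* `two_mul_card_mul_eStar_le` — the finite-energy floor in `Finset` form: `2·#F·E* ≤ Σ_{p ∈ F} Σ_{q ∈ F∖p} V_LJ`
  for every finite `F ⊆ ℝ³` (tree: `card_mul_eStar_le`, periodisation).
* `not_uniformly_superBound` — **no non-empty uniformly discrete `X ⊆ ℝ³` has `U_X(p) ≤ 2E* − θ` at every
  site** (`θ > 0`).  Proof (a Følner/growth argument, no structure of `X` used): truncate the site sums of the
  finite cluster `F_R = X ∩ B̄(0,R)` — at depth `≥ L` below the sphere the discarded tail is `≤ θ/2`
  (`sum_le_tsum_add_of_far`, `L³ ≳ δ⁻³/θ`), in the collar it is `≤ K_δ = (1/6)·1024/δ⁶`; comparing with the floor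
  `2·#F_R·E*` gives `(θ/2)·#F_{R−L} ≤ K_δ·(#F_R − #F_{R−L})`, i.e. `#F_{R−L} ≤ ρ·#F_R` with `ρ < 1`: the ball
  counts grow geometrically in `R`, against the cubic packing bound (`card_le_of_separated_of_dist_le`).
  Consequences: the crux's conclusion with `= 2E*` replaced by `≤ 2E* − θ` is unsatisfiable (whatever the
  ground states are), `transitiveLocalLimit_level_not_lowerable`; in the sibling crux M* (uniform binding
  `≤ 2E*`) the hypothesis is the minimax-extremal one with ZERO slack for every `X`, not only for periodic `X`
  (`UniformBindingRigidity.Negative.PeriodicCeiling`): `iSup_site_eq` — a uniformly `2E*`-bound `X` has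
  `sup_p U_X(p) = 2E*` exactly.
All `[folklore]`.
-/

noncomputable section

namespace Summit.AtomisticToContinuum.Crystallization.Theorems.TransitiveLocalLimit.Negative.UniformFloor

open Filter Metric
open scoped Topology
open Literature.MathematicalPhysics.StatisticalMechanics
open Summit.AtomisticToContinuum.Crystallization.Theorems.ChargedEnergyGapNegative (E3 eStar card_mul_eStar_le)
open Summit.AtomisticToContinuum.Crystallization.Theorems.PerronTransitivityUniformBindingRigidity
  (sum_le_tsum_add_of_far finite_sep_ball)

/-! ## The energy floor in `Finset` form -/

/-- `2·#F·E* ≤ Σ_{p ∈ F} Σ_{q ∈ F ∖ {p}} V_LJ(dist p q)` for every finite set `F ⊆ ℝ³`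
(enumerate `F`, `card_mul_eStar_le`, `V_LJ(0) = 0`). [folklore] -/
theorem two_mul_card_mul_eStar_le (F : Finset E3) :
    2 * ((F.card : ℝ) * eStar) ≤ ∑ p ∈ F, ∑ q ∈ F.erase p, lennardJones (dist p q) := by
  classical
  set e := F.equivFin
  set y : Fin F.card → E3 := fun i => ((e.symm i : {x // x ∈ F}) : E3) with hy_def
  have hy : Function.Injective y := fun i j h => e.symm.injective (Subtype.ext h)
  have h1 := card_mul_eStar_le hy
  have h2 := two_mul_interactionEnergy_eq_sum_sum lennardJones lennardJones_zero y
  have inner : ∀ p : E3, ∑ k, lennardJones (dist p (y k)) = ∑ q ∈ F, lennardJones (dist p q) := fun p => by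
    calc ∑ k, lennardJones (dist p (y k))
        = ∑ a : {x // x ∈ F}, lennardJones (dist p (a : E3)) :=
          Equiv.sum_comp e.symm (fun a : {x // x ∈ F} => lennardJones (dist p (a : E3)))
      _ = ∑ q ∈ F, lennardJones (dist p q) := Finset.sum_coe_sort F (fun q => lennardJones (dist p q))
  have h3 : ∑ i, ∑ k, lennardJones (dist (y i) (y k)) = ∑ p ∈ F, ∑ q ∈ F, lennardJones (dist p q) := by
    simp_rw [inner]
    calc ∑ i, ∑ q ∈ F, lennardJones (dist (y i) q)
        = ∑ a : {x // x ∈ F}, ∑ q ∈ F, lennardJones (dist (a : E3) q) :=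
          Equiv.sum_comp e.symm (fun a : {x // x ∈ F} => ∑ q ∈ F, lennardJones (dist (a : E3) q))
      _ = ∑ p ∈ F, ∑ q ∈ F, lennardJones (dist p q) :=
          Finset.sum_coe_sort F (fun p => ∑ q ∈ F, lennardJones (dist p q))
  have h4 : ∑ p ∈ F, ∑ q ∈ F.erase p, lennardJones (dist p q) = ∑ p ∈ F, ∑ q ∈ F, lennardJones (dist p q) := by
    refine Finset.sum_congr rfl fun p hp => ?_
    rw [← Finset.add_sum_erase F _ hp, dist_self, lennardJones_zero, zero_add]
  linarith [h1, h2, h3, h4]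

/-! ## Packing -/

/-- A `δ`-separated finite subset of the ball `B̄(0,R)` of `ℝ³` has at most `(2R/δ + 1)³` points. [folklore] -/
theorem card_le_cube {δ R : ℝ} (hδ : 0 < δ) (hR : 0 ≤ R) (F : Finset E3)
    (hF : ∀ c ∈ F, dist c 0 ≤ R) (hsep : ∀ c ∈ F, ∀ d ∈ F, c ≠ d → δ ≤ dist c d) :
    (F.card : ℝ) ≤ (2 * R / δ + 1) ^ 3 := by
  have h := card_le_of_separated_of_dist_le F (0 : E3) hδ hR hF hsep
  rwa [finrank_euclideanSpace_fin] at h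

/-! ## No configuration is uniformly super-bound -/

/-- **`2E*` is the uniform binding floor.** A non-empty uniformly discrete `X ⊆ ℝ³` cannot have
`U_X(p) ≤ 2E* − θ` at every site, for any `θ > 0`. [folklore] -/
theorem not_uniformly_superBound {X : Set (EuclideanSpace ℝ (Fin 3))} (hne : X.Nonempty) {δ : ℝ} (hδ : 0 < δ)
    (hsep : ∀ p ∈ X, ∀ q ∈ X, p ≠ q → δ ≤ dist p q) {θ : ℝ} (hθ : 0 < θ)
    (hU : ∀ p ∈ X, ∑' q : {q : EuclideanSpace ℝ (Fin 3) // q ∈ X ∧ q ≠ p}, lennardJones (dist p q.1) ≤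
      2 * (⨅ Q : PeriodicConfiguration 3, Q.energyPerParticle lennardJones) - θ) : False := by
  classical
  change ∀ p ∈ X, _ ≤ 2 * eStar - θ at hU
  -- the finite clusters `F R = X ∩ B̄(0,R)` and their cardinalities
  set F : ℝ → Finset E3 := fun R => (finite_sep_ball hδ hsep 0 R).toFinset with hF_def
  have memF : ∀ R q, q ∈ F R ↔ q ∈ X ∧ dist q 0 ≤ R := fun R q => by
    simp only [hF_def, Set.Finite.mem_toFinset, Set.mem_setOf_eq]
  set n : ℝ → ℝ := fun R => ((F R).card : ℝ) with hn_def
  have n_nonneg : ∀ R, 0 ≤ n R := fun R => Nat.cast_nonneg _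
  -- constants: collar cost `Kδ`, depth `L` with tail `≤ θ/2`, contraction ratio `ρ`
  set Kδ : ℝ := 1 / 6 * (1024 / (δ ^ 3 * δ ^ 3)) with hKδ_def
  have hKδ : 0 < Kδ := by positivity
  set L : ℝ := max δ (max 1 (1024 / (3 * θ * δ ^ 3))) with hL_def
  have hLδ : δ ≤ L := le_max_left _ _
  have hL1 : 1 ≤ L := (le_max_left _ _).trans (le_max_right _ _)
  have hL0 : 0 ≤ L := zero_le_one.trans hL1
  have hLtail : 1 / 6 * (1024 / (δ ^ 3 * L ^ 3)) ≤ θ / 2 := by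
    have h1 : 1024 / (3 * θ * δ ^ 3) ≤ L := (le_max_right _ _).trans (le_max_right _ _)
    rw [div_le_iff₀ (by positivity)] at h1
    have h2 : L ≤ L ^ 3 := le_self_pow₀ hL1 (by norm_num)
    have h3 : 3 * θ * δ ^ 3 * L ≤ 3 * θ * δ ^ 3 * L ^ 3 :=
      mul_le_mul_of_nonneg_left h2 (by positivity)
    rw [show (1 : ℝ) / 6 * (1024 / (δ ^ 3 * L ^ 3)) = 1024 / (6 * (δ ^ 3 * L ^ 3)) by ring,
      div_le_iff₀ (by positivity)]
    nlinarith
  set ρ : ℝ := Kδ / (θ / 2 + Kδ) with hρ_def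
  have hρ0 : 0 < ρ := by positivity
  have hρ1 : ρ < 1 := by
    rw [hρ_def, div_lt_one (by positivity)]
    linarith
  -- ONE STEP: `n (R - L) ≤ ρ · n R`
  have step : ∀ R : ℝ, n (R - L) ≤ ρ * n R := by
    intro R
    have hfloor := two_mul_card_mul_eStar_le (F R)
    -- truncation of the site sums of the cluster
    have hI : ∀ p, ∀ b ∈ (F R).erase p, b ∈ X ∧ b ≠ p := fun p b hb => by
      obtain ⟨hbp, hbF⟩ := Finset.mem_erase.1 hb
      exact ⟨((memF R b).1 hbF).1, hbp⟩
    have hin : ∀ p ∈ F R, dist p 0 ≤ R - L →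
        ∑ q ∈ (F R).erase p, lennardJones (dist p q) ≤ 2 * eStar - θ / 2 := by
      intro p hp hpin
      have hpX : p ∈ X := ((memF R p).1 hp).1
      have hfar : ∀ b ∈ X, b ≠ p → b ∉ (F R).erase p → L ≤ dist b p := by
        intro b hb hbp hbI
        have hbF : b ∉ F R := fun h => hbI (Finset.mem_erase.2 ⟨hbp, h⟩)
        rw [memF] at hbF
        have hbR : R < dist b 0 := by
          by_contra h
          exact hbF ⟨hb, not_lt.1 h⟩
        have := dist_triangle b p 0
        linarith
      have h := sum_le_tsum_add_of_far hδ hsep p hLδ ((F R).erase p) (hI p) hfar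
      have hUp := hU p hpX
      linarith
    have hout : ∀ p ∈ F R, ∑ q ∈ (F R).erase p, lennardJones (dist p q) ≤ 2 * eStar - θ + Kδ := by
      intro p hp
      have hpX : p ∈ X := ((memF R p).1 hp).1
      have hfar : ∀ b ∈ X, b ≠ p → b ∉ (F R).erase p → δ ≤ dist b p := fun b hb hbp _ =>
        hsep b hb p hpX hbp
      have h := sum_le_tsum_add_of_far hδ hsep p le_rfl ((F R).erase p) (hI p) hfar
      have hUp := hU p hpX
      simp only [hKδ_def]
      linarith
    -- sum the per-site bounds with the depth indicator
    have hsum : ∑ p ∈ F R, ∑ q ∈ (F R).erase p, lennardJones (dist p q) ≤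
        ∑ p ∈ F R, (if dist p 0 ≤ R - L then 2 * eStar - θ / 2 else 2 * eStar - θ + Kδ) := by
      refine Finset.sum_le_sum fun p hp => ?_
      split_ifs with h
      · exact hin p hp h
      · exact hout p hp
    have hfilter : (F R).filter (fun p => dist p 0 ≤ R - L) = F (R - L) := by
      ext q
      simp only [Finset.mem_filter, memF]
      constructor
      · rintro ⟨⟨hq, -⟩, h⟩
        exact ⟨hq, h⟩
      · rintro ⟨hq, h⟩
        exact ⟨⟨hq, h.trans (by linarith)⟩, h⟩
    have hcount : ((F R).filter (fun p => dist p 0 ≤ R - L)).card +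
        ((F R).filter (fun p => ¬ dist p 0 ≤ R - L)).card = (F R).card :=
      Finset.card_filter_add_card_filter_not _
    rw [Finset.sum_ite, Finset.sum_const, Finset.sum_const, nsmul_eq_mul, nsmul_eq_mul, hfilter] at hsum
    rw [hfilter] at hcount
    have hcount' : (((F R).filter (fun p => ¬ dist p 0 ≤ R - L)).card : ℝ) = n R - n (R - L) := by
      have := congrArg (fun m : ℕ => (m : ℝ)) hcount
      push_cast at this
      simp only [hn_def]
      linarith
    rw [hcount'] at hsum
    -- `2·n R·E* ≤ n(R-L)(2E* − θ/2) + (n R − n(R−L))(2E* − θ + Kδ)`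
    have key : θ / 2 * n (R - L) ≤ Kδ * (n R - n (R - L)) := by
      have h0 : n (R - L) ≤ n R := by
        simp only [hn_def]
        exact_mod_cast Finset.card_le_card (fun q hq => by
          rw [memF] at hq ⊢
          exact ⟨hq.1, hq.2.trans (by linarith)⟩)
      simp only [hn_def] at hfloor hsum h0 ⊢
      nlinarith
    rw [hρ_def, div_mul_eq_mul_div, le_div_iff₀ (by positivity)]
    nlinarith
  -- ITERATE from a point of `X`
  obtain ⟨p₀, hp₀⟩ := hne
  set R₀ : ℝ := dist p₀ 0 with hR₀_def
  have hR₀ : 0 ≤ R₀ := dist_nonneg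
  have hstart : 1 ≤ n R₀ := by
    simp only [hn_def]
    have : p₀ ∈ F R₀ := (memF R₀ p₀).2 ⟨hp₀, le_rfl⟩
    exact_mod_cast Finset.card_pos.2 ⟨p₀, this⟩
  have iter : ∀ k : ℕ, n R₀ ≤ ρ ^ k * n (R₀ + k * L) := by
    intro k
    induction k with
    | zero => simp
    | succ k ih =>
      have hs := step (R₀ + (k + 1 : ℕ) * L)
      have hrw : R₀ + ((k + 1 : ℕ) : ℝ) * L - L = R₀ + (k : ℝ) * L := by push_cast; ring
      rw [hrw] at hs
      calc n R₀ ≤ ρ ^ k * n (R₀ + k * L) := ih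
        _ ≤ ρ ^ k * (ρ * n (R₀ + (k + 1 : ℕ) * L)) := mul_le_mul_of_nonneg_left hs (pow_nonneg hρ0.le k)
        _ = ρ ^ (k + 1) * n (R₀ + (k + 1 : ℕ) * L) := by ring
  -- packing: `n (R₀ + kL) ≤ (2(R₀ + kL)/δ + 1)³ ≤ C³ (k+1)³`
  set C : ℝ := 2 * (R₀ + L) / δ + 1 with hC_def
  have hC : 0 ≤ C := by positivity
  have pack : ∀ k : ℕ, n (R₀ + k * L) ≤ C ^ 3 * ((k : ℝ) + 1) ^ 3 := by
    intro k
    have hRk : 0 ≤ R₀ + k * L := by positivity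
    have h1 : n (R₀ + k * L) ≤ (2 * (R₀ + k * L) / δ + 1) ^ 3 :=
      card_le_cube hδ hRk (F (R₀ + k * L)) (fun c hc => ((memF _ c).1 hc).2)
        (fun c hc d hd hcd => hsep c ((memF _ c).1 hc).1 d ((memF _ d).1 hd).1 hcd)
    have h2 : 2 * (R₀ + k * L) / δ + 1 ≤ C * ((k : ℝ) + 1) := by
      rw [hC_def, add_mul, div_mul_eq_mul_div, div_add' _ _ _ hδ.ne', div_add' _ _ _ hδ.ne',
        div_le_div_iff_of_pos_right hδ]
      nlinarith [mul_nonneg hR₀ (k.cast_nonneg : (0 : ℝ) ≤ k), hL0, hδ.le,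
        mul_nonneg hδ.le (k.cast_nonneg : (0 : ℝ) ≤ k)]
    have h3 : (2 * (R₀ + k * L) / δ + 1) ^ 3 ≤ (C * ((k : ℝ) + 1)) ^ 3 :=
      pow_le_pow_left₀ (by positivity) h2 3
    calc n (R₀ + k * L) ≤ (2 * (R₀ + k * L) / δ + 1) ^ 3 := h1
      _ ≤ (C * ((k : ℝ) + 1)) ^ 3 := h3
      _ = C ^ 3 * ((k : ℝ) + 1) ^ 3 := by ring
  -- the geometric decay beats the cubic growth
  have hlim : Tendsto (fun k : ℕ => C ^ 3 / ρ * ((((k + 1 : ℕ) : ℝ)) ^ 3 * ρ ^ (k + 1))) atTop (𝓝 0) := by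
    have habs : |ρ| < 1 := by rw [abs_of_pos hρ0]; exact hρ1
    have h := (tendsto_pow_const_mul_const_pow_of_abs_lt_one 3 habs).comp (tendsto_add_atTop_nat 1)
    have h' := h.const_mul (C ^ 3 / ρ)
    rw [mul_zero] at h'
    exact h'
  have hev := hlim.eventually (gt_mem_nhds one_pos)
  obtain ⟨k, hk⟩ := hev.exists
  have hk' : C ^ 3 / ρ * ((((k + 1 : ℕ) : ℝ)) ^ 3 * ρ ^ (k + 1)) = ρ ^ k * (C ^ 3 * ((k : ℝ) + 1) ^ 3) := by
    push_cast
    field_simp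
    ring
  rw [hk'] at hk
  have h1 := iter k
  have h2 := pack k
  have h3 : ρ ^ k * n (R₀ + k * L) ≤ ρ ^ k * (C ^ 3 * ((k : ℝ) + 1) ^ 3) :=
    mul_le_mul_of_nonneg_left h2 (pow_nonneg hρ0.le k)
  linarith

/-! ## Consequences for the crux and for M* -/

/-- **The level of the crux cannot be lowered**: the conclusion of `TransitiveLocalLimit` with `= 2E*` replaced
by `≤ 2E* − θ` (`θ > 0`) is unsatisfiable by ANY non-empty uniformly discrete `X` — in particular by any local
limit of any sequence of configurations, ground states or not. [folklore] -/
theorem transitiveLocalLimit_level_not_lowerable {θ : ℝ} (hθ : 0 < θ) :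
    ¬ ∃ X : Set (EuclideanSpace ℝ (Fin 3)), X.Nonempty ∧
        (∃ δ : ℝ, 0 < δ ∧ ∀ p ∈ X, ∀ q ∈ X, p ≠ q → δ ≤ dist p q) ∧
        ∀ p ∈ X, ∑' q : {q : EuclideanSpace ℝ (Fin 3) // q ∈ X ∧ q ≠ p}, lennardJones (dist p q.1) ≤
          2 * (⨅ Q : PeriodicConfiguration 3, Q.energyPerParticle lennardJones) - θ := by
  rintro ⟨X, hne, ⟨δ, hδ, hsep⟩, hU⟩
  exact not_uniformly_superBound hne hδ hsep hθ hU

/-- **Zero slack in M*, for every configuration**: a non-empty uniformly discrete uniformly `2E*`-bound `X`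
has sites bound no better than `2E* − θ`, for every `θ > 0` (so `sup_p U_X(p) = 2E*` exactly). [folklore] -/
theorem exists_site_gt_of_uniformly_bound {X : Set (EuclideanSpace ℝ (Fin 3))} (hne : X.Nonempty) {δ : ℝ}
    (hδ : 0 < δ) (hsep : ∀ p ∈ X, ∀ q ∈ X, p ≠ q → δ ≤ dist p q) {θ : ℝ} (hθ : 0 < θ) :
    ∃ p ∈ X, 2 * (⨅ Q : PeriodicConfiguration 3, Q.energyPerParticle lennardJones) - θ <
      ∑' q : {q : EuclideanSpace ℝ (Fin 3) // q ∈ X ∧ q ≠ p}, lennardJones (dist p q.1) := by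
  by_contra h
  push Not at h
  exact not_uniformly_superBound hne hδ hsep hθ h

end Summit.AtomisticToContinuum.Crystallization.Theorems.TransitiveLocalLimit.Negative.UniformFloor

end
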